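import Summits.ResolutionOfSingularities.ResolutionOfSingularities.Theorems.MarkedTransferCampaignW46TypedProcedureAnchors
import Literature.AlgebraicGeometry.Resolution.RegularCentreBlowupSeqIntegral
import Literature.AlgebraicGeometry.Resolution.BlowupsExistence
import Literature.AlgebraicGeometry.Resolution.BlowupsIntegral
import Literature.AlgebraicGeometry.Resolution.SmoothOfRegularPerfectField
import Literature.AlgebraicGeometry.Resolution.PointCentrePermissible
import Literature.AlgebraicGeometry.Resolution.SmoothStalksRegular
import HarnessLib

/-!
# [OURS · L1 W4.6 rung (i), negative half] Under the LITERAL centre rule the typed Th. 16.6 procedure does not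
# terminate in any regime `dimLE d` containing an unresolved state with infinite singular locus — for EVERY notion
# instance whose résumés cover such states («procrastination»)
# (cell res-hironaka, LADDER-RESOLUTION rung L, D-0089; campaign s46, prover res-L1-s46-pv-1; host route
# MarkedTransfer, `--supports stmt-ResolutionOfSingularities-16155`)

HONEST FRAMING. Nothing here is a statement of H. Hironaka's manuscript (2017-03-23, [Hironaka2017]) and nothing
here asserts or denies any statement of it. This file proves a theorem about the OURS typed procedure of the shared
campaign module `Theorems.MarkedTransferCampaignW46TypedProcedure` (res-L1-type-o1, p465445): its centre rule
`CampaignW46.IsCentre` is the LITERAL reading of Th. 16.6 p.84 l.4–6 «`D` any smooth closed irreducible subscheme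
of `∇(E)`», which admits, in particular, every CLOSED POINT of `∇(E)`. The typed candidate carriers of rung S enter
only as the posited résumés of `CampaignW46.Run` (their Def. 15.12 hypothesis fields give `∇(E) ≠ ∅` closed and
`∇(E) ⊆ Sing(E)`), and as the HYPOTHESIS `hcov` below («résumés exist for the states in question»), never as
assertions. All geometric inputs are THEOREMS of the tree's `Literature.AlgebraicGeometry.Resolution` library
(blow-ups exist, are proper and integral, preserve regularity along regular centres and do not raise dimension;
off the centre a blow-up does not change `Sing`; regular + finite type over a perfect field ⇒ smooth). AI review is
weaker than expert review. No `sorry`; axioms standard.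

## The theorem (`not_terminates_dimLE_of_resumesCover`) and what it means for rung (i)

Fix a perfect field `K` of characteristic `p`, a notion instance `N`, a reading `Rd` and `d : ℕ`. SUPPOSE
(`hcov`) that every STANDARD ideal exponent `E` («`J ≠ (0)`, `b > 0`») with INFINITE singular locus `Sing(E)` on
an ambient datum of dimension `≤ d` admits a résumé read by `Rd` (i.e. the typed procedure can treat such states
at all), and that ONE such state exists (e.g. `(𝓘_D, 1)` for a smooth curve `D` in the affine plane, `d = 2`).
THEN `¬ CampaignW46.Terminates N Rd (Regime.dimLE d)`: there is an infinite run of the typed procedure inside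
`dimLE d`. The run («procrastination», `exists_procrastinatingStep`): at a state with résumé `R`, the terminal plat
`∇(E)` is non-empty and closed, hence contains a closed point `x` (schemes of finite type over a field are
Jacobson); `{x}` is a centre admitted by the literal rule (irreducible; smooth over the perfect `K` because the
reduced point is a regular scheme of finite type); blowing it up gives an ambient datum of dimension `≤ d` on
which the transform `E′` is again standard and — since the blow-up is an isomorphism off `x` and `Sing(E) ∖ {x}`
is infinite — again has infinite singular locus; `hcov` supplies the next résumé; iterate (`procrastination`).

CONSEQUENCE FOR THE CAMPAIGN (OURS, about OURS statements): a W4.6 rung of the shape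
`Terminates N Rd (Regime.dimLE d)` (or any regime stable under point blow-ups and containing a state with
infinite `Sing`) is REFUTED for every instance `N` satisfying the coverage hypothesis — by a run that never
touches the singularity it postpones. Hence a TRUE termination rung about the typed procedure in dimension `≥ 2`
must either (a) restrict the regime so that admissible centres exhaust the singular locus in finitely many steps
(e.g. `Sing(E)` finite at every stage — then every admitted centre is a point of `Sing(E)`), or (b) strengthen the
centre rule beyond the literal reading (e.g. `D = ∇(E)`, the case of Th. 16.6 (4), or `D` a connected component
of `∇(E)`), or (c) exhibit an instance `N` whose résumés never exist at states with positive-dimensional singular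
locus (which would make the procedure inapplicable to a smooth curve with `b = 1`). Which of these the campaign
adopts is res-L1-s46-plan-1's decision; this file only proves the dichotomy's negative horn.

## Contents

* `ResumesCover N Rd S` — «every state in the class `S` has a résumé read by `Rd`» (coverage hypothesis shape).
* `exists_procrastinatingStep` — the one-step engine described above.
* `PState`, `PState.next`, `PState.seq`, `procrastination` — the infinite run assembled by recursion.
* `not_terminates_dimLE_of_resumesCover` — the theorem; `not_terminates_top_of_resumesCover` — the same for the
  unrestricted regime.

## References

* companion modules `MarkedTransferCampaignW46TypedProcedure` (DESIGN POINTS (CTR), (REG), (VAC)),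
  `MarkedTransferCampaignW46TypedProcedureAnchors`; plan/RESCUE-SEED.md §1 row W4.6.
* H. Hironaka, ms. 2017-03-23, Th. 16.6 p.84 l.4–9 (centre rule, (1)), l.29 ((4) «the case in which `D = ∇`»),
  §16.3 p.87 l.14–28 (Th. 16.13 «repeatedly but finitely many times»), Def. 15.12 p.80 l.37 – p.81 l.2 — scope only,
  under adjudication, not cited as fact. [Hironaka2017]
* Tree theorems used: `Resolution.exists_isBlowup`, `IsBlowup.isProper`, `IsBlowup.isIntegral`,
  `IsBlowup.isRegular_of_isRegular_subscheme` [cite: Liu2002, Thm. 8.1.19 (a)], `IsBlowup.topologicalKrullDim_le`,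
  `IsBlowup.mem_support_transform_iff_of_not_mem` [cite: StacksProject, Tag 02OS], `IsBlowup.comap_ne_bot`,
  `smooth_of_isRegular_of_perfectField` [cite: StacksProject, Tag 00TV],
  `isRegular_subscheme_vanishingIdeal_singleton`, `isRegularLocalRing_stalk_of_smooth_of_field`
  [cite: StacksProject, Tag 056S].
-/

noncomputable section

set_option linter.dupNamespace false -- mandated namespace of this single-conjunct summit

open CategoryTheory AlgebraicGeometry TopologicalSpace

namespace Summit.ResolutionOfSingularities.ResolutionOfSingularities.Theorems

namespace CampaignW46

open Literature.AlgebraicGeometry.Resolution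
open Literature.AlgebraicGeometry.Hironaka2017.S02Preliminaries
open Literature.AlgebraicGeometry.Hironaka2017.Datum
open Literature.AlgebraicGeometry.Hironaka2017.S15ARSchemes
open Literature.AlgebraicGeometry.Hironaka2017.S16Proof
open Scheme.IdealSheafData

universe u

variable {n : ℕ} {p : ℕ} [Fact p.Prime] {K : Type u} [Field K] [CharP K p]

/-! ## Coverage hypothesis shape -/

/-- [OURS · L1 W4.6] NOT a statement of the manuscript. «The typed procedure (instance `N`, reading `Rd`) HAS A
RÉSUMÉ for every state in the class `S`»: the shape of the coverage hypothesis of the procrastination theorem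
(résumé EXISTENCE is posited data of the typed rows — row 091 `U78L2`, Def. 15.8 — never constructed here).
[folklore] -/
def ResumesCover (N : Notions.{u} n) (Rd : Reading p K N)
    (S : ∀ A : AmbientDatum p K, IdealExponent A.Z → Prop) : Prop :=
  ∀ (A : AmbientDatum p K) (E : IdealExponent A.Z), S A E → ∃ R : Resume N A E, Rd A E R

/-! ## Geometry of an ambient datum (tree theorems, assembled) -/

section Ambient

variable (A : AmbientDatum p K)

/-- An ambient scheme is locally Noetherian (finite type over a field). [folklore] -/
theorem ambient_isLocallyNoetherian : IsLocallyNoetherian A.Z :=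
  haveI := A.smooth
  LocallyOfFiniteType.isLocallyNoetherian A.hom

/-- An ambient scheme is regular (smooth over a field, Stacks 056S). [cite: StacksProject, Tag 056S] -/
theorem ambient_isRegular : Scheme.IsRegular A.Z :=
  haveI := A.smooth
  fun z => isRegularLocalRing_stalk_of_smooth_of_field A.hom z

/-- An ambient scheme is integral (irreducible, and reduced since smooth over a field). [folklore] -/
theorem ambient_isIntegral : IsIntegral A.Z :=
  haveI := A.smooth
  haveI := A.irreducible
  haveI : IsReduced A.Z := isReduced_of_smooth A.hom
  isIntegral_of_irreducibleSpace_of_isReduced A.Z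

/-- An ambient scheme is a Jacobson space (finite type over a field). [folklore] -/
theorem ambient_jacobsonSpace : JacobsonSpace A.Z :=
  haveI := A.smooth
  LocallyOfFiniteType.jacobsonSpace A.hom

end Ambient

/-! ## The singular locus off the centre survives a blow-up -/

/-- Off the centre a blow-up does not change the singular locus of an ideal exponent: for `π` a blowing up along
(the reduced ideal of) a closed `D` and `ξ′` with `π ξ′ ∉ D`, `ξ′ ∈ Sing(E′)` iff `π ξ′ ∈ Sing(E)` (`E′` the
transform, Def. 2.1; tree `IsBlowup.mem_support_transform_iff_of_not_mem`). [cite: StacksProject, Tag 02OS] -/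
theorem mem_sing_transform_iff_of_not_mem {Z Z' : Scheme.{u}} [IsLocallyNoetherian Z'] {π : Z' ⟶ Z}
    {D : Closeds Z} (hπ : IsBlowup π (vanishingIdeal D)) (E : IdealExponent Z) {ξ' : Z'}
    (hξ : π ξ' ∉ (D : Set Z)) : ξ' ∈ (E.transform π D).sing ↔ π ξ' ∈ E.sing := by
  have hξ' : π ξ' ∉ (vanishingIdeal D).support := by
    rwa [← SetLike.mem_coe, coe_support_vanishingIdeal]
  exact hπ.mem_support_transform_iff_of_not_mem ⟨E.J, [], E.b⟩ hξ'

/-- If `Sing(E)` is infinite and `π` blows up a closed point, `Sing(E′)` is infinite: `Sing(E) ∖ {x}` is infinite,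
every point off `x` has a preimage (the blow-up is an isomorphism over `Z ∖ {x}`), and preimages of singular
points off `x` are singular. [cite: StacksProject, Tag 02OS] -/
theorem sing_transform_infinite {Z Z' : Scheme.{u}} [IsLocallyNoetherian Z'] {π : Z' ⟶ Z} {x : Z}
    (hx : IsClosed ({x} : Set Z)) (hπ : IsBlowup π (vanishingIdeal ⟨{x}, hx⟩)) (E : IdealExponent Z)
    (hinf : E.sing.Infinite) : (E.transform π ⟨{x}, hx⟩).sing.Infinite := by
  classical
  set D : Closeds Z := ⟨{x}, hx⟩ with hD
  -- `Sing(E) ∖ {x}` is infinite and lies in the range of `π`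
  have hS : (E.sing \ {x}).Infinite := hinf.sdiff (Set.finite_singleton x)
  have hrange : E.sing \ {x} ⊆ Set.range π.base := by
    intro y hy
    have hyD : y ∉ (vanishingIdeal D).support := by
      rw [← SetLike.mem_coe, coe_support_vanishingIdeal]
      exact hy.2
    set W₀ : Z.Opens := ⟨((vanishingIdeal D).support : Set Z)ᶜ, (vanishingIdeal D).support.isClosed.isOpen_compl⟩
    haveI : IsIso (π ∣_ W₀) := hπ.isIso_compl
    obtain ⟨y', hy'⟩ := (ConcreteCategory.bijective_of_isIso ((π ∣_ W₀).base)).2 ⟨y, hyD⟩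
    refine ⟨y'.1, ?_⟩
    have := congrArg Subtype.val hy'
    rwa [morphismRestrict_base_coe] at this
  have hpre : (π.base ⁻¹' (E.sing \ {x})).Infinite := hS.preimage hrange
  refine hpre.mono ?_
  intro ξ' hξ'
  have hnot : π ξ' ∉ (D : Set Z) := hξ'.2
  exact (mem_sing_transform_iff_of_not_mem hπ E hnot).2 hξ'.1

/-! ## One procrastinating step -/

section Step

variable [PerfectField K] {N : Notions.{u} n} {Rd : Reading p K N}

/-- **The engine.** [OURS · L1 W4.6] NOT a statement of the manuscript. At any state `(A, E)` carrying a résumé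
`R` (so `∇(E) ≠ ∅` is closed and `E` is standard) with `Sing(E)` infinite, the LITERAL centre rule admits the
blow-up of a closed point `x ∈ ∇(E)`, and this step leads to an ambient datum of no larger dimension on which the
transform is again standard with infinite singular locus. [folklore] -/
theorem exists_procrastinatingStep {A : AmbientDatum p K} {E : IdealExponent A.Z} (R : Resume N A E)
    (hinf : E.sing.Infinite) :
    ∃ (A' : AmbientDatum p K) (s : Step R A'),
      s.E'.IsStandard ∧ s.E'.sing.Infinite ∧
        ∀ d : ℕ, topologicalKrullDim A.Z ≤ (d : WithBot ℕ∞) → topologicalKrullDim A'.Z ≤ (d : WithBot ℕ∞) := by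
  classical
  haveI := A.smooth
  haveI := A.irreducible
  haveI := A.quasiCompact
  haveI : IsLocallyNoetherian A.Z := ambient_isLocallyNoetherian A
  haveI : IsIntegral A.Z := ambient_isIntegral A
  haveI : JacobsonSpace A.Z := ambient_jacobsonSpace A
  have hZreg : Scheme.IsRegular A.Z := ambient_isRegular A
  -- a closed point of the terminal plat `∇(E)`
  have hN : IsSmoothClosedNonempty A.hom (R.𝒴.nabla R.T) := R.nabla_smooth
  obtain ⟨hNcl, hNne, -⟩ := hN
  obtain ⟨x, hxN, hxcl⟩ := nonempty_inter_closedPoints hNne hNcl.isLocallyClosed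
  rw [mem_closedPoints_iff] at hxcl
  let D : Closeds A.Z := ⟨{x}, hxcl⟩
  -- the literal centre rule admits `{x}`
  have hreg : Scheme.IsRegular (vanishingIdeal D).subscheme := isRegular_subscheme_vanishingIdeal_singleton hxcl
  have hcentre : IsCentre R D :=
    { subset_nabla := Set.singleton_subset_iff.2 hxN
      irreducible := isIrreducible_singleton
      smooth := smooth_of_isRegular_of_perfectField _ hreg }
  -- the blow-up of `Z` at `x`
  obtain ⟨Z', π, hπ⟩ := exists_isBlowup A.Z (vanishingIdeal D)
  -- `{x} ≠ Z` (the singular locus is infinite), so the centre ideal is non-zero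
  have hE : E.IsStandard := R.mti_isStandard.1
  obtain ⟨y, hy, hyx⟩ : ∃ y ∈ E.sing, y ≠ x := by
    by_contra! h
    exact hinf ((Set.finite_singleton x).subset fun y hy => h y hy)
  have hne : ({x} : Set A.Z) ≠ Set.univ := fun h => hyx (by
    have : y ∈ ({x} : Set A.Z) := h ▸ Set.mem_univ y
    exact this)
  have hDtop : (vanishingIdeal D).support ≠ ⊤ := by
    intro h
    apply hne
    have := congrArg (fun S : Closeds A.Z => (S : Set A.Z)) h
    simpa [coe_support_vanishingIdeal, D] using this
  have hDne : vanishingIdeal D ≠ ⊥ := fun h => hDtop (by rw [h, Scheme.IdealSheafData.support_bot])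
  haveI : IsIntegral Z' := hπ.isIntegral hDne
  haveI : IsProper π := hπ.isProper
  have hZ'reg : Scheme.IsRegular Z' := hπ.isRegular_of_isRegular_subscheme hZreg hreg
  haveI : Smooth (π ≫ A.hom) := smooth_of_isRegular_of_perfectField _ hZ'reg
  let A' : AmbientDatum p K :=
    { Z := Z', hom := π ≫ A.hom, irreducible := inferInstance, smooth := inferInstance,
      quasiCompact := inferInstance }
  let s : Step R A' := { D := D, centre := hcentre, π := π, hom_eq := rfl, blowup := hπ }
  haveI : IsLocallyNoetherian A'.Z := ambient_isLocallyNoetherian A'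
  refine ⟨A', s, ⟨?_, hE.2⟩, ?_, fun d hd => hπ.topologicalKrullDim_le hd⟩
  · -- `J′ ⊇ J𝒪_{Z′} ≠ 0`
    intro hbot
    apply hπ.comap_ne_bot hDtop hE.1
    have hle : E.J.comap π ≤ (s.E').J := comap_le_controlledTransform π (vanishingIdeal D) E.J E.b
    rw [hbot] at hle
    exact le_bot_iff.1 hle
  · exact sing_transform_infinite hxcl hπ E hinf

end Step

/-! ## The infinite run -/

section Run

variable [PerfectField K] {N : Notions.{u} n} {Rd : Reading p K N} {d : ℕ}

/-- [OURS · L1 W4.6] Bookkeeping: a state of the procrastinating run — ambient datum of dimension `≤ d`, ideal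
exponent with infinite singular locus, a résumé read by `Rd`. [folklore] -/
structure PState (N : Notions.{u} n) (Rd : Reading p K N) (d : ℕ) where
  /-- ambient datum -/
  A : AmbientDatum p K
  /-- ideal exponent -/
  E : IdealExponent A.Z
  /-- résumé -/
  R : Resume N A E
  /-- read by `Rd` -/
  reads : Rd A E R
  /-- dimension bound -/
  dim : topologicalKrullDim A.Z ≤ (d : WithBot ℕ∞)
  /-- infinite singular locus -/
  inf : E.sing.Infinite

/-- [OURS · L1 W4.6] Bookkeeping: a procrastinating step out of a state, with its target state. [folklore] -/
structure PState.Link (S : PState N Rd d) where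
  /-- the next state -/
  S' : PState N Rd d
  /-- the typed step -/
  s : Step S.R S'.A
  /-- the next ideal exponent is the transform -/
  hE : S'.E = s.E'

/-- The next state exists (engine + coverage). [folklore] -/
theorem PState.nonempty_link
    (hcov : ResumesCover N Rd fun A E => topologicalKrullDim A.Z ≤ (d : WithBot ℕ∞) ∧ E.IsStandard ∧ E.sing.Infinite)
    (S : PState N Rd d) : Nonempty S.Link := by
  obtain ⟨A', s, hst, hinf, hdim⟩ := exists_procrastinatingStep S.R S.inf
  obtain ⟨R', hR'⟩ := hcov A' s.E' ⟨hdim d S.dim, hst, hinf⟩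
  exact ⟨⟨⟨A', s.E', R', hR', hdim d S.dim, hinf⟩, s, rfl⟩⟩

/-- A chosen next state. [folklore] -/
def PState.next
    (hcov : ResumesCover N Rd fun A E => topologicalKrullDim A.Z ≤ (d : WithBot ℕ∞) ∧ E.IsStandard ∧ E.sing.Infinite)
    (S : PState N Rd d) : S.Link :=
  Classical.choice (S.nonempty_link hcov)

/-- The sequence of states from an initial one. [folklore] -/
def PState.seq
    (hcov : ResumesCover N Rd fun A E => topologicalKrullDim A.Z ≤ (d : WithBot ℕ∞) ∧ E.IsStandard ∧ E.sing.Infinite)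
    (S₀ : PState N Rd d) : ℕ → PState N Rd d
  | 0 => S₀
  | k + 1 => ((PState.seq hcov S₀ k).next hcov).S'

/-- [OURS · L1 W4.6] NOT a statement of the manuscript. **The procrastinating run**: an infinite run of the typed
procedure, every stage of dimension `≤ d` with infinite singular locus, from any such initial state — given
coverage. [folklore] -/
def procrastination
    (hcov : ResumesCover N Rd fun A E => topologicalKrullDim A.Z ≤ (d : WithBot ℕ∞) ∧ E.IsStandard ∧ E.sing.Infinite)
    (S₀ : PState N Rd d) : Run N Rd where
  A k := (S₀.seq hcov k).A
  E k := (S₀.seq hcov k).E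
  R k := (S₀.seq hcov k).R
  reads k := (S₀.seq hcov k).reads
  step k := ((S₀.seq hcov k).next hcov).s
  E_succ k := ((S₀.seq hcov k).next hcov).hE

/-- Every stage of the procrastinating run lies in `dimLE d`. [folklore] -/
theorem procrastination_dimLE
    (hcov : ResumesCover N Rd fun A E => topologicalKrullDim A.Z ≤ (d : WithBot ℕ∞) ∧ E.IsStandard ∧ E.sing.Infinite)
    (S₀ : PState N Rd d) (k : ℕ) :
    Regime.dimLE d ((procrastination hcov S₀).A k) ((procrastination hcov S₀).E k) :=
  (S₀.seq hcov k).dim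

end Run

/-! ## The theorem -/

/-- **Procrastination (negative half of rung (i) for the LITERAL centre rule).** [OURS · L1 W4.6] NOT a statement
of the manuscript and not a claim about it. For every notion instance `N` and reading `Rd` over a perfect field:
if the typed procedure has a résumé for every standard ideal exponent with infinite singular locus on ambient data
of dimension `≤ d` (`hcov`), and one such state exists, then the typed Th. 16.6 procedure with the literal centre
rule «any smooth closed irreducible `D ⊆ ∇(E)`» does NOT terminate in the regime `dimLE d`: blowing up closed
points of `∇(E)` forever is a run. [folklore] -/
theorem not_terminates_dimLE_of_resumesCover [PerfectField K] (N : Notions.{u} n) (Rd : Reading p K N) (d : ℕ)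
    (hcov : ResumesCover N Rd fun A E => topologicalKrullDim A.Z ≤ (d : WithBot ℕ∞) ∧ E.IsStandard ∧ E.sing.Infinite)
    {A₀ : AmbientDatum p K} {E₀ : IdealExponent A₀.Z} (h₀d : topologicalKrullDim A₀.Z ≤ (d : WithBot ℕ∞))
    (h₀s : E₀.IsStandard) (h₀i : E₀.sing.Infinite) : ¬ Terminates N Rd (Regime.dimLE d) := by
  obtain ⟨R₀, hR₀⟩ := hcov A₀ E₀ ⟨h₀d, h₀s, h₀i⟩
  let S₀ : PState N Rd d := ⟨A₀, E₀, R₀, hR₀, h₀d, h₀i⟩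
  exact fun hT => hT (procrastination hcov S₀) (procrastination_dimLE hcov S₀)

/-- The same for the unrestricted regime (`Regime.top`). [folklore] -/
theorem not_terminates_top_of_resumesCover [PerfectField K] (N : Notions.{u} n) (Rd : Reading p K N) (d : ℕ)
    (hcov : ResumesCover N Rd fun A E => topologicalKrullDim A.Z ≤ (d : WithBot ℕ∞) ∧ E.IsStandard ∧ E.sing.Infinite)
    {A₀ : AmbientDatum p K} {E₀ : IdealExponent A₀.Z} (h₀d : topologicalKrullDim A₀.Z ≤ (d : WithBot ℕ∞))
    (h₀s : E₀.IsStandard) (h₀i : E₀.sing.Infinite) : ¬ Terminates N Rd Regime.top :=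
  fun hT => not_terminates_dimLE_of_resumesCover N Rd d hcov h₀d h₀s h₀i
    (terminates_antitone (fun _ _ _ => trivial) hT)

end CampaignW46

end Summit.ResolutionOfSingularities.ResolutionOfSingularities.Theorems

end
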